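import Mathlib.RingTheory.Support
import Mathlib.RingTheory.LocalRing.Module
import Mathlib.RingTheory.Localization.Away.Basic
import Mathlib.RingTheory.TensorProduct.Basic
import Mathlib.LinearAlgebra.TensorProduct.RightExactness
import Mathlib.Algebra.Module.Projective
import HarnessLib

/-!
# Cohomology and base change when the top fibre cohomology vanishes: `d ⊗ κ(𝔭)` onto ⇒ `d` onto near `𝔭`, split,
# with kernel finite projective and commuting with base change (Mumford AV §5 Cor. 2–3; EGA III 7.7.10; Hartshorne III 12.11)

Topic `Algebra/Module`; namespace `Literature.Algebra.Module`; THEOREMS ONLY (Mathlib only; no definition, no named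
fact, no instance, no notation, no `sorry`).  The linear algebra of «cohomology and base change» ABOVE the vanishing line
for a two-term complex `d : K⁰ → K¹` of modules over a commutative ring `A` (the degree-`(r−1, r)` step of a
Grothendieck complex `K•`; sibling of ★ `Algebra/Module/TwoTermComplexBaseChange`, which treats the kernel side /
semicontinuity of `h⁰`):

* §1 **`surjective_baseChange_iff_subsingleton_tensor_coker`** — for any `A`-algebra `B`, `d ⊗ B` is onto iff
  `B ⊗_A coker d = 0` (right exactness of `B ⊗_A −`); hence, for `K¹` finite, **`surjective_baseChange_residueField_iff`**:
  `d ⊗ κ(𝔭)` is onto iff `𝔭 ∉ Supp (coker d)` (Nakayama, Mathlib `Module.mem_support_iff_nontrivial_residueField_tensorProduct`),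
  and **`exists_surjective_baseChange_away`**: if `d ⊗ κ(𝔭)` is onto then `d ⊗ A_g` is onto for some `g ∉ 𝔭`
  (`Supp` of a finite module is closed, Mathlib `Module.support_eq_zeroLocus`) — «`H^r(X_𝔭, F_𝔭) = 0 ⇒ H^r = 0` near `𝔭`».
* §2 for `d` ONTO a projective `K¹`: the sequence `0 → ker d → K⁰ → K¹ → 0` splits, so **`projective_ker_of_surjective`**,
  **`finite_ker_of_surjective`**, and **`nonempty_baseChange_kerEquiv_of_surjective`** — `B ⊗_A ker d ≃ₗ[B] ker (d ⊗ B)`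
  (over the inclusion into `B ⊗_A K⁰`) for EVERY `A`-algebra `B`: «`H^{r−1}` is locally free and commutes with arbitrary
  base change» once `H^r` of the fibre vanishes.

Cell `hodgecm-mathlib` (D-0151), F-DAG (h2) «cohomology and base change» (price sheet v0.1 §3 F-2 (2b), §5 item 2;
consumer: relative ampleness EGA III 4.7.1 on proper flat families).  Count-neutral capital; HC_CM is proved only modulo
the 7 printed citations until rung 0 closes; nothing here is about HC.

## References
* [MumfordAV1970] D. Mumford, *Abelian Varieties* (1970), §5, Cor. 2 and Cor. 3 (pp. 50, 53).
* [Hartshorne1977] R. Hartshorne, *Algebraic Geometry*, III Prop. 12.4, Thm. 12.11 (pp. 286–290).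
* A. Grothendieck, EGA III₂ (1963), 7.7.5, 7.7.10, 7.8.4.
* [GortzWedhorn2023] U. Görtz, T. Wedhorn, *Algebraic Geometry II* (2023), Thm. 23.140, Cor. 23.142.
-/

universe u

open TensorProduct Module

noncomputable section

namespace Literature.Algebra.Module

variable {A : Type u} [CommRing A] {K0 K1 : Type u} [AddCommGroup K0] [Module A K0] [AddCommGroup K1] [Module A K1]

/-! ### §1 Surjectivity of `d ⊗ B` and the support of the cokernel -/

/-- **`d ⊗ B` is onto iff `B ⊗_A coker d = 0`** (right exactness of `B ⊗_A −` on `K⁰ → K¹ → coker d → 0`).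
[cite: MumfordAV1970, §5 Cor. 2 (p. 50)] -/
theorem surjective_baseChange_iff_subsingleton_tensor_coker (d : K0 →ₗ[A] K1) (B : Type u) [CommRing B] [Algebra A B] :
    Function.Surjective (d.baseChange B) ↔ Subsingleton (B ⊗[A] (K1 ⧸ LinearMap.range d)) := by
  -- the exact sequence `B ⊗ K⁰ → B ⊗ K¹ → B ⊗ coker d → 0`
  have hex : Function.Exact (d.lTensor B) ((LinearMap.range d).mkQ.lTensor B) :=
    lTensor_exact B (LinearMap.exact_map_mkQ_range d) (Submodule.mkQ_surjective _)
  have hsurj : Function.Surjective ((LinearMap.range d).mkQ.lTensor B) :=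
    LinearMap.lTensor_surjective B (Submodule.mkQ_surjective _)
  have hbc : (d.baseChange B : B ⊗[A] K0 → B ⊗[A] K1) = d.lTensor B := rfl
  rw [hbc]
  constructor
  · intro h
    -- `mkQ ⊗ B` vanishes on the range of `d ⊗ B = everything`, and is onto
    refine ⟨fun x y => ?_⟩
    obtain ⟨x', rfl⟩ := hsurj x
    obtain ⟨y', rfl⟩ := hsurj y
    obtain ⟨x'', rfl⟩ := h x'
    obtain ⟨y'', rfl⟩ := h y'
    rw [hex.apply_apply_eq_zero, hex.apply_apply_eq_zero]
  · intro h y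
    -- `mkQ ⊗ B` is the zero map to a trivial module, so its kernel (= range of `d ⊗ B`) is everything
    have hy : ((LinearMap.range d).mkQ.lTensor B) y = 0 := Subsingleton.elim _ _
    exact (hex y).1 hy

/-- **`d ⊗ κ(𝔭)` is onto iff `𝔭 ∉ Supp (coker d)`** for `K¹` finite (Nakayama at the residue field).
[cite: MumfordAV1970, §5 Cor. 2 (p. 50)] [cite: Hartshorne1977, III Prop. 12.4 (p. 286)] -/
theorem surjective_baseChange_residueField_iff [Module.Finite A K1] (d : K0 →ₗ[A] K1) (p : PrimeSpectrum A) :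
    Function.Surjective (d.baseChange p.asIdeal.ResidueField) ↔ p ∉ Module.support A (K1 ⧸ LinearMap.range d) := by
  rw [surjective_baseChange_iff_subsingleton_tensor_coker, Module.mem_support_iff_nontrivial_residueField_tensorProduct,
    not_nontrivial_iff_subsingleton]

/-- **If `d ⊗ κ(𝔭)` is onto then `d ⊗ A_g` is onto for some `g ∉ 𝔭`** (`K¹` finite): the support of the finite module
`coker d` is the closed set `V(Ann)`, so some `g ∈ Ann (coker d)` avoids `𝔭`, and `g` kills `coker d`.  «If the top
cohomology of the fibre at `𝔭` vanishes, it vanishes over a neighbourhood `D(g)`.»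
[cite: MumfordAV1970, §5 Cor. 3 (p. 53)] [cite: Hartshorne1977, III Thm. 12.11 (p. 290)] -/
theorem exists_surjective_baseChange_away [Module.Finite A K1] (d : K0 →ₗ[A] K1) (p : PrimeSpectrum A)
    (h : Function.Surjective (d.baseChange p.asIdeal.ResidueField)) :
    ∃ g : A, g ∉ p.asIdeal ∧ Function.Surjective (d.baseChange (Localization.Away g)) := by
  have hp : p ∉ Module.support A (K1 ⧸ LinearMap.range d) := (surjective_baseChange_residueField_iff d p).1 h
  rw [Module.support_eq_zeroLocus, PrimeSpectrum.mem_zeroLocus, Set.not_subset] at hp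
  obtain ⟨g, hg, hgp⟩ := hp
  refine ⟨g, hgp, ?_⟩
  rw [surjective_baseChange_iff_subsingleton_tensor_coker]
  -- `g` kills `coker d`, and `g` is a unit in `A_g`
  refine ⟨fun x y => ?_⟩
  have hkill : ∀ z : Localization.Away g ⊗[A] (K1 ⧸ LinearMap.range d), z = 0 := by
    intro z
    have hu : IsUnit (algebraMap A (Localization.Away g) g) := IsLocalization.Away.algebraMap_isUnit g
    obtain ⟨u, hu'⟩ := hu
    have hz : algebraMap A (Localization.Away g) g • z = 0 := by
      rw [algebraMap_smul]
      induction z using TensorProduct.induction_on with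
      | zero => rw [smul_zero]
      | tmul b m => rw [TensorProduct.smul_tmul', TensorProduct.smul_tmul, Module.mem_annihilator.1 hg m, TensorProduct.tmul_zero]
      | add z₁ z₂ h₁ h₂ => rw [smul_add, h₁, h₂, add_zero]
    have : (u : Localization.Away g) • z = 0 := by rw [hu']; exact hz
    simpa using congrArg (fun w => (↑u⁻¹ : Localization.Away g) • w) this
  rw [hkill x, hkill y]

/-- Surjectivity of `d ⊗ B` persists along any further base change `B → C`. [cite: MumfordAV1970, §5 Cor. 2 (p. 50)] -/
theorem surjective_baseChange_of_surjective (d : K0 →ₗ[A] K1) (hd : Function.Surjective d) (B : Type u) [CommRing B]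
    [Algebra A B] : Function.Surjective (d.baseChange B) :=
  LinearMap.lTensor_surjective B hd

/-! ### §2 A surjection onto a projective module: split kernel, finite projective, commuting with base change -/

/-- **The kernel of a surjection onto a projective module is projective** (the sequence splits).
[cite: Hartshorne1977, III Prop. 12.4 (p. 286)] -/
theorem projective_ker_of_surjective [Module.Projective A K0] [Module.Projective A K1] (d : K0 →ₗ[A] K1)
    (hd : Function.Surjective d) : Module.Projective A (LinearMap.ker d) := by
  obtain ⟨s, hs⟩ := Module.projective_lifting_property d (LinearMap.id : K1 →ₗ[A] K1) hd
  -- the retraction `r = 1 − s d : K⁰ → ker d`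
  have hr : ∀ x : K0, x - s (d x) ∈ LinearMap.ker d := fun x => by
    rw [LinearMap.mem_ker, map_sub, ← LinearMap.comp_apply, hs, LinearMap.id_apply, sub_self]
  let r : K0 →ₗ[A] LinearMap.ker d :=
    { toFun := fun x => ⟨x - s (d x), hr x⟩
      map_add' := fun x y => by ext; simp only [map_add, Submodule.coe_add]; abel
      map_smul' := fun a x => by ext; simp only [map_smul, RingHom.id_apply, SetLike.val_smul, smul_sub] }
  refine Module.Projective.of_split (LinearMap.ker d).subtype r (LinearMap.ext fun x => ?_)
  ext
  change (x : K0) - s (d (x : K0)) = x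
  rw [LinearMap.mem_ker.1 x.2, map_zero, sub_zero]

/-- **The kernel of a surjection from a finite module onto a projective module is finite** (a direct summand).
[cite: Hartshorne1977, III Prop. 12.4 (p. 286)] -/
theorem finite_ker_of_surjective [Module.Finite A K0] [Module.Projective A K1] (d : K0 →ₗ[A] K1)
    (hd : Function.Surjective d) : Module.Finite A (LinearMap.ker d) := by
  obtain ⟨s, hs⟩ := Module.projective_lifting_property d (LinearMap.id : K1 →ₗ[A] K1) hd
  have hr : ∀ x : K0, x - s (d x) ∈ LinearMap.ker d := fun x => by
    rw [LinearMap.mem_ker, map_sub, ← LinearMap.comp_apply, hs, LinearMap.id_apply, sub_self]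
  let r : K0 →ₗ[A] LinearMap.ker d :=
    { toFun := fun x => ⟨x - s (d x), hr x⟩
      map_add' := fun x y => by ext; simp only [map_add, Submodule.coe_add]; abel
      map_smul' := fun a x => by ext; simp only [map_smul, RingHom.id_apply, SetLike.val_smul, smul_sub] }
  refine Module.Finite.of_surjective r fun x => ⟨x, ?_⟩
  ext
  change (x : K0) - s (d (x : K0)) = x
  rw [LinearMap.mem_ker.1 x.2, map_zero, sub_zero]

/-- **`B ⊗_A ker d ≃ ker (d ⊗ B)` for a surjection onto a projective module**, for EVERY `A`-algebra `B`, compatibly with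
the inclusions into `B ⊗_A K⁰` — «once `H^r` of the fibre vanishes, `H^{r−1}` commutes with arbitrary base change».
[cite: MumfordAV1970, §5 Cor. 2 (p. 50) and Cor. 3 (p. 53)] [cite: Hartshorne1977, III Thm. 12.11 (b) (p. 290)] -/
theorem nonempty_baseChange_kerEquiv_of_surjective [Module.Projective A K1] (d : K0 →ₗ[A] K1)
    (hd : Function.Surjective d) (B : Type u) [CommRing B] [Algebra A B] :
    ∃ e : B ⊗[A] LinearMap.ker d ≃ₗ[B] LinearMap.ker (d.baseChange B),
      ∀ z, ((e z : B ⊗[A] K0)) = (LinearMap.ker d).subtype.baseChange B z := by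
  obtain ⟨s, hs⟩ := Module.projective_lifting_property d (LinearMap.id : K1 →ₗ[A] K1) hd
  have hr : ∀ x : K0, x - s (d x) ∈ LinearMap.ker d := fun x => by
    rw [LinearMap.mem_ker, map_sub, ← LinearMap.comp_apply, hs, LinearMap.id_apply, sub_self]
  let r : K0 →ₗ[A] LinearMap.ker d :=
    { toFun := fun x => ⟨x - s (d x), hr x⟩
      map_add' := fun x y => by ext; simp only [map_add, Submodule.coe_add]; abel
      map_smul' := fun a x => by ext; simp only [map_smul, RingHom.id_apply, SetLike.val_smul, smul_sub] }
  have hri : r.comp (LinearMap.ker d).subtype = LinearMap.id := LinearMap.ext fun x => by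
    ext
    change (x : K0) - s (d (x : K0)) = x
    rw [LinearMap.mem_ker.1 x.2, map_zero, sub_zero]
  -- `ι ⊗ B` is injective (retraction `r ⊗ B`) with range `ker (d ⊗ B)` (right exactness)
  have hinj : Function.Injective ((LinearMap.ker d).subtype.baseChange B) := by
    intro x y hxy
    have h := congrArg (r.baseChange B) hxy
    rwa [← LinearMap.comp_apply, ← LinearMap.comp_apply, ← LinearMap.baseChange_comp, hri, LinearMap.baseChange_id,
      LinearMap.id_apply, LinearMap.id_apply] at h
  have hex : Function.Exact ((LinearMap.ker d).subtype.baseChange B) (d.baseChange B) :=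
    lTensor_exact B (LinearMap.exact_subtype_ker_map d) hd
  refine ⟨(LinearEquiv.ofInjective _ hinj).trans (LinearEquiv.ofEq _ _ (LinearMap.exact_iff.1 hex).symm), fun z => rfl⟩

end Literature.Algebra.Module

end
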